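import Mathlib.Analysis.Fourier.AddCircleMulti
import Mathlib.Analysis.Fourier.PoissonSummation
import Mathlib.Analysis.SpecialFunctions.Gaussian.FourierTransform
import Mathlib.Algebra.Module.ZLattice.Summable
import Mathlib.MeasureTheory.Measure.Haar.InnerProductSpace
import Mathlib.Analysis.SpecialFunctions.JapaneseBracket
import Mathlib.Topology.Algebra.Group.Quotient
import Literature.NumberTheory.LFunctions.DedekindZetaMellinProofs

/-!
# The Poisson summation formula for lattices in euclidean spaces (Neukirch VII (3.2)) — proofs

Discharge of the named fact `Literature.NumberTheory.LFunctions.poissonSummation_zlattice`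
(`Literature/NumberTheory/LFunctions/DedekindZetaTheta.lean`; Neukirch, *Algebraic Number Theory*,
Ch. VII (3.2) Proposition): for a complete lattice `Γ` in a euclidean vector space `V` and a
Schwartz function `f`, `∑_{g ∈ Γ} f(g) = vol(Γ)⁻¹ ∑_{g' ∈ Γ'} f̂(g')`.

## Proof architecture (Neukirch VII §3, (3.2) and its proof, pp. 446–448 of the English edition)

1. **The integer lattice** (`tsum_eq_tsum_fourier_intLattice`): for `Γ = ℤⁿ ⊂ ℝⁿ`
   (`EuclideanSpace ℝ ι`) and `f` continuous with `|f(x)| ≤ C (1 + ‖x‖)^{-b}`, `b > n`, whose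
   Fourier transform is summable over `ℤⁿ`: the periodisation `F(x) = ∑_{n ∈ ℤⁿ} f(x + n)` is a
   continuous function on the torus `ℝⁿ/ℤⁿ` (Mathlib `UnitAddTorus`), its Fourier coefficients are
   `F̂(m) = f̂(m)` (unfolding the cube integral over the translates of the unit cube,
   `mFourierCoeff_periodization`), and the Fourier series of `F` converges to `F` at `0`
   (Mathlib `UnitAddTorus.hasSum_mFourier_series_apply_of_summable`). This is Neukirch's argument
   verbatim, with Mathlib's multivariate Fourier series on `UnitAddTorus` in place of his appeal to
   [98, chap. VII §1.7].
2. **General lattices** (`tsum_eq_tsum_fourier_of_rpow_decay`): a `ℤ`-basis of `Γ` gives a linear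
   isomorphism `A : ℝⁿ → V` with `A(ℤⁿ) = Γ`; `f ∘ A` satisfies the hypotheses of step 1, its
   Fourier transform is `(f ∘ A)^(ξ) = vol(Γ)⁻¹ f̂(A^* ξ)` where `A^*` maps `ℤⁿ` onto the dual
   lattice `Γ'` (dual basis, `Literature.Algebra.EuclideanLattices.dualLattice`), and `vol(Γ)⁻¹` is the Jacobian of `A`
   (`A(unit cube)` is a fundamental mesh of `Γ`). Neukirch reduces to `ℤⁿ` by a `ℤ`-basis of `Γ`
   in the same way (proof of (3.2): "`f_A(y) = |det A|⁻¹ f̂(ᵗA⁻¹ y)`").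
3. **Schwartz functions** (`poissonSummation_zlattice_holds`): Schwartz functions and their Fourier
   transforms decay faster than any power (Mathlib `SchwartzMap.one_add_le_sup_seminorm_apply`,
   `SchwartzMap.fourierTransformCLM`), and rapidly decaying functions are summable over lattices
   (`ZLattice.summable_norm_rpow`).

The decay form of step 2 (rather than the Schwartz form) is what the theta transformation formula
needs (Gaussians). No new definitions are introduced. The integer-lattice bookkeeping (lattice vectors
with integer coordinates, tiling of `ℝⁿ` by unit cubes) is imported from
`DedekindZetaMellinProofs.lean`, where it serves Hecke's unfolding over the units.
-/

noncomputable section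

open MeasureTheory Filter Set Submodule Complex
open scoped Real Topology FourierTransform ENNReal SchwartzMap

namespace Literature.NumberTheory.LFunctions

namespace Fourier

/-! ## Step 1: the integer lattice `ℤⁿ ⊂ ℝⁿ` -/

section IntLattice

variable {ι : Type*} [Fintype ι]

omit [Fintype ι] in
/-- The integer vector `n ↦ (n_i)` vanishes only for `n = 0`. [folklore] -/
theorem intCast_vec_eq_zero_iff (n : ι → ℤ) : (fun i ↦ (n i : ℝ)) = 0 ↔ n = 0 := by
  constructor
  · intro h
    funext i
    have := congr_fun h i
    simpa using this
  · rintro rfl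
    funext i
    simp

/-- **Lattice `p`-series on `ℤⁿ`**: `∑_{n ∈ ℤⁿ} (1 + ‖n‖)^{-b} < ∞` for `b > n`
(Mathlib `ZLattice.summable_norm_rpow` for the lattice `ℤⁿ ⊂ ℝⁿ`). [folklore] -/
theorem summable_one_add_norm_rpow_neg {b : ℝ} (hb : (Fintype.card ι : ℝ) < b) :
    Summable fun n : ι → ℤ ↦ (1 + ‖(fun i ↦ (n i : ℝ))‖) ^ (-b) := by
  classical
  set L : Submodule ℤ (ι → ℝ) := span ℤ (Set.range (Pi.basisFun ℝ ι)) with hL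
  have hrank : (-b) < -(Module.finrank ℤ L : ℝ) := by
    rw [ZLattice.rank ℝ L, Module.finrank_fintype_fun_eq_card]
    linarith
  have h1 : Summable fun z : L ↦ ‖z‖ ^ (-b) := ZLattice.summable_norm_rpow L (-b) hrank
  let e : (ι → ℤ) ≃ L := ((Pi.basisFun ℝ ι).restrictScalars ℤ).equivFun.toEquiv.symm
  have h2 : Summable fun n : ι → ℤ ↦ ‖(fun i ↦ (n i : ℝ))‖ ^ (-b) := by
    have := (e.summable_iff (f := fun z : L ↦ ‖z‖ ^ (-b))).mpr h1
    refine this.congr fun n ↦ ?_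
    show ‖((((Pi.basisFun ℝ ι).restrictScalars ℤ).equivFun.symm n : L) : ι → ℝ)‖ ^ (-b) = _
    rw [NumberField.coe_restrictScalars_basisFun_equivFun_symm n]
  refine Summable.of_norm_bounded_eventually h2 ?_
  refine Filter.eventually_cofinite.mpr ((Set.finite_singleton (0 : ι → ℤ)).subset fun n hn ↦ ?_)
  rw [Set.mem_singleton_iff]
  by_contra h0
  apply hn
  have hne : (fun i ↦ (n i : ℝ)) ≠ 0 := fun h ↦ h0 ((intCast_vec_eq_zero_iff n).mp h)
  have hpos : 0 < ‖(fun i ↦ (n i : ℝ))‖ := norm_pos_iff.mpr hne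
  rw [Real.norm_of_nonneg (Real.rpow_nonneg (by positivity) _)]
  exact Real.rpow_le_rpow_of_nonpos hpos (le_add_of_nonneg_left zero_le_one) (by linarith)

/-! ### Tiling `ℝⁿ` by the integer translates of the unit cube -/

/-- **Tiling** (`ℝ≥0∞`-valued): `∫_{ℝⁿ} G = ∑_{m ∈ ℤⁿ} ∫_{[0,1)ⁿ} G(x + m) dx` for every measurable
`G ≥ 0`; the half-open-cube form of `Literature.NumberTheory.LFunctions.NumberField.lintegral_eq_tsum_lintegral_unitCube_add_intCast`
(`DedekindZetaMellinProofs.lean`, closed cube; the two cubes are a.e. equal,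
`Measure.univ_pi_Ico_ae_eq_Icc`). [folklore] -/
theorem lintegral_eq_tsum_lintegral_cube (G : (ι → ℝ) → ℝ≥0∞) :
    ∫⁻ x, G x = ∑' m : ι → ℤ, ∫⁻ x in Set.pi Set.univ (fun _ ↦ Set.Ico (0 : ℝ) 1),
      G (x + fun i ↦ (m i : ℝ)) := by
  have hae : (Set.pi Set.univ fun _ ↦ Set.Ico (0 : ℝ) 1) =ᵐ[volume] Set.Icc (0 : ι → ℝ) 1 :=
    Measure.univ_pi_Ico_ae_eq_Icc (μ := fun _ : ι ↦ (volume : Measure ℝ)) (f := 0) (g := 1)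
  simp_rw [NumberField.lintegral_eq_tsum_lintegral_unitCube_add_intCast G, Measure.restrict_congr_set hae]

/-- **Tiling** (Bochner): `∫_{ℝⁿ} G = ∑_{m ∈ ℤⁿ} ∫_{[0,1)ⁿ} G(x + m) dx` for `G` integrable
(Mathlib `IsAddFundamentalDomain.integral_eq_tsum''`). [folklore] -/
theorem integral_eq_tsum_integral_cube {G : (ι → ℝ) → ℂ} (hG : Integrable G) :
    ∫ x, G x = ∑' m : ι → ℤ, ∫ x in Set.pi Set.univ (fun _ ↦ Set.Ico (0 : ℝ) 1),
      G (x + fun i ↦ (m i : ℝ)) := by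
  classical
  haveI : Countable (span ℤ (Set.range (Pi.basisFun ℝ ι))).toAddSubgroup :=
    Finsupp.instCountableSubtypeMemSubmoduleSpanRange _
  rw [(ZSpan.isAddFundamentalDomain' (Pi.basisFun ℝ ι) volume).integral_eq_tsum'' G hG,
    ZSpan.fundamentalDomain_pi_basisFun]
  let e : (ι → ℤ) ≃ (span ℤ (Set.range (Pi.basisFun ℝ ι))).toAddSubgroup :=
    ((Pi.basisFun ℝ ι).restrictScalars ℤ).equivFun.toEquiv.symm
  rw [← e.tsum_eq]
  refine tsum_congr fun m ↦ integral_congr_ae (ae_of_all _ fun x ↦ ?_)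
  show G (((((Pi.basisFun ℝ ι).restrictScalars ℤ).equivFun.symm m :
    span ℤ (Set.range (Pi.basisFun ℝ ι))) : ι → ℝ) + x) = _
  rw [NumberField.coe_restrictScalars_basisFun_equivFun_symm m, add_comm]

/-! ### The periodisation `∑_{n ∈ ℤⁿ} g(x + n)` of a decaying function -/

/-- A decay constant is nonnegative. [folklore] -/
theorem decayConst_nonneg {X : Type*} [NormedAddCommGroup X] {g : X → ℂ} {C b : ℝ}
    (hg : ∀ x, ‖g x‖ ≤ C * (1 + ‖x‖) ^ (-b)) : 0 ≤ C := by
  have h := hg 0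
  rw [norm_zero, add_zero, Real.one_rpow, mul_one] at h
  exact (norm_nonneg _).trans h

/-- **Local uniform bound for the translates**: if `|g(x)| ≤ C (1 + ‖x‖)^{-b}` then for `‖x‖ ≤ R`,
`|g(x + n)| ≤ C (1 + R)^b (1 + ‖n‖)^{-b}`. [folklore] -/
theorem norm_translate_le {g : (ι → ℝ) → ℂ} {C b : ℝ} (hb : 0 ≤ b)
    (hg : ∀ x, ‖g x‖ ≤ C * (1 + ‖x‖) ^ (-b)) {R : ℝ} (hR : 0 ≤ R) {x : ι → ℝ} (hx : ‖x‖ ≤ R)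
    (n : ι → ℤ) :
    ‖g (x + fun i ↦ (n i : ℝ))‖ ≤
      C * (1 + R) ^ b * (1 + ‖(fun i ↦ (n i : ℝ))‖) ^ (-b) := by
  have hC := decayConst_nonneg hg
  set v : ι → ℝ := fun i ↦ (n i : ℝ) with hv
  have hvn : ‖v‖ ≤ ‖x + v‖ + R := by
    have : ‖v‖ ≤ ‖x + v‖ + ‖x‖ := by
      calc ‖v‖ = ‖(x + v) - x‖ := by rw [add_sub_cancel_left]
        _ ≤ ‖x + v‖ + ‖x‖ := norm_sub_le _ _
    linarith
  have hkey : (1 + ‖v‖) / (1 + R) ≤ 1 + ‖x + v‖ := by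
    rw [div_le_iff₀ (by positivity)]
    have : 0 ≤ R * ‖x + v‖ := by positivity
    nlinarith
  have hpos : 0 < (1 + ‖v‖) / (1 + R) := by positivity
  have hb' : -b ≤ 0 := by linarith
  calc ‖g (x + v)‖ ≤ C * (1 + ‖x + v‖) ^ (-b) := hg _
    _ ≤ C * ((1 + ‖v‖) / (1 + R)) ^ (-b) :=
        mul_le_mul_of_nonneg_left (Real.rpow_le_rpow_of_nonpos hpos hkey hb') hC
    _ = C * (1 + R) ^ b * (1 + ‖v‖) ^ (-b) := by
        rw [Real.div_rpow (by positivity) (by positivity), Real.rpow_neg (by positivity : (0:ℝ) ≤ 1 + R),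
          div_inv_eq_mul]
        ring

/-- **Summability of the translates** at every point. [folklore] -/
theorem summable_translate {g : (ι → ℝ) → ℂ} {C b : ℝ} (hb : (Fintype.card ι : ℝ) < b)
    (hg : ∀ x, ‖g x‖ ≤ C * (1 + ‖x‖) ^ (-b)) (x : ι → ℝ) :
    Summable fun n : ι → ℤ ↦ g (x + fun i ↦ (n i : ℝ)) := by
  have hb0 : 0 ≤ b := le_trans (Nat.cast_nonneg _) hb.le
  refine Summable.of_norm_bounded ((summable_one_add_norm_rpow_neg hb).mul_left (C * (1 + ‖x‖) ^ b))
    fun n ↦ ?_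
  exact norm_translate_le hb0 hg (norm_nonneg x) le_rfl n

/-- **Continuity of the periodisation** `x ↦ ∑_{n ∈ ℤⁿ} g(x + n)` of a continuous function with
`|g(x)| ≤ C(1 + ‖x‖)^{-b}`, `b > n` (locally uniform convergence, Weierstrass `M`-test). [folklore] -/
theorem continuous_periodization {g : (ι → ℝ) → ℂ} (hgc : Continuous g) {C b : ℝ}
    (hb : (Fintype.card ι : ℝ) < b) (hg : ∀ x, ‖g x‖ ≤ C * (1 + ‖x‖) ^ (-b)) :
    Continuous fun x : ι → ℝ ↦ ∑' n : ι → ℤ, g (x + fun i ↦ (n i : ℝ)) := by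
  have hb0 : 0 ≤ b := le_trans (Nat.cast_nonneg _) hb.le
  refine continuous_iff_continuousAt.mpr fun x₀ ↦ ?_
  set R : ℝ := ‖x₀‖ + 1 with hR
  have hR0 : 0 ≤ R := by positivity
  have hcont : ContinuousOn (fun x : ι → ℝ ↦ ∑' n : ι → ℤ, g (x + fun i ↦ (n i : ℝ)))
      (Metric.ball 0 R) := by
    refine continuousOn_tsum (fun n ↦ ?_)
      ((summable_one_add_norm_rpow_neg hb).mul_left (C * (1 + R) ^ b)) (fun n x hx ↦ ?_)
    · exact (hgc.comp (continuous_id.add continuous_const)).continuousOn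
    · rw [Metric.mem_ball, dist_zero_right] at hx
      exact norm_translate_le hb0 hg hR0 hx.le n
  exact hcont.continuousAt (Metric.isOpen_ball.mem_nhds (by simp [hR]))

omit [Fintype ι] in
/-- **Periodicity of the periodisation** under `ℤⁿ`. [folklore] -/
theorem periodization_add_intCast (g : (ι → ℝ) → ℂ) (x : ι → ℝ) (k : ι → ℤ) :
    (∑' n : ι → ℤ, g (x + (fun i ↦ (k i : ℝ)) + fun i ↦ (n i : ℝ))) =
      ∑' n : ι → ℤ, g (x + fun i ↦ (n i : ℝ)) := by
  conv_rhs => rw [← (Equiv.addLeft k).tsum_eq]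
  refine tsum_congr fun n ↦ ?_
  congr 1
  funext i
  simp only [Pi.add_apply, Equiv.coe_addLeft, Int.cast_add]
  ring

omit [Fintype ι] in
/-- **Descent to the torus**: a continuous `ℤⁿ`-periodic function on `ℝⁿ` is the pull-back of a
continuous function on `ℝⁿ/ℤⁿ = UnitAddTorus ι` (the projection is an open quotient map, Mathlib
`QuotientAddGroup.isOpenQuotientMap_mk`, `IsOpenQuotientMap.piMap`). [folklore] -/
theorem exists_continuousMap_torus {P : (ι → ℝ) → ℂ} (hP : Continuous P)
    (hper : ∀ (x : ι → ℝ) (k : ι → ℤ), P (x + fun i ↦ (k i : ℝ)) = P x) :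
    ∃ F : C(UnitAddTorus ι, ℂ), ∀ x : ι → ℝ, F (fun i ↦ ((x i : ℝ) : UnitAddCircle)) = P x := by
  let σ : UnitAddTorus ι → (ι → ℝ) := fun t i ↦ ((AddCircle.equivIco (1 : ℝ) 0 (t i) : ℝ))
  have hσ : ∀ x : ι → ℝ, P (σ (fun i ↦ ((x i : ℝ) : UnitAddCircle))) = P x := by
    intro x
    have : σ (fun i ↦ ((x i : ℝ) : UnitAddCircle)) = x + fun i ↦ ((-⌊x i⌋ : ℤ) : ℝ) := by
      funext i
      simp only [σ, AddCircle.coe_equivIco_mk_apply, div_one, mul_one, Pi.add_apply, Int.cast_neg]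
      rw [← Int.self_sub_floor]
      ring
    rw [this, hper]
  have hπ : IsOpenQuotientMap (fun (x : ι → ℝ) (i : ι) ↦ ((x i : ℝ) : UnitAddCircle)) :=
    IsOpenQuotientMap.piMap (f := fun (_ : ι) (r : ℝ) ↦ ((r : ℝ) : UnitAddCircle))
      fun _ ↦ QuotientAddGroup.isOpenQuotientMap_mk
  refine ⟨⟨fun t ↦ P (σ t), ?_⟩, fun x ↦ hσ x⟩
  rw [← hπ.continuous_comp_iff]
  have : (fun t ↦ P (σ t)) ∘ (fun (x : ι → ℝ) (i : ι) ↦ ((x i : ℝ) : UnitAddCircle)) = P := funext hσ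
  rw [this]
  exact hP

/-- The exponential monomials of `UnitAddTorus ι` pulled back to `ℝⁿ`:
`e_m(x) = exp(2πi ∑_i m_i x_i)`. [folklore] -/
theorem mFourier_apply_coe (m : ι → ℤ) (x : ι → ℝ) :
    UnitAddTorus.mFourier m (fun i ↦ ((x i : ℝ) : UnitAddCircle)) =
      Complex.exp (2 * π * Complex.I * ∑ i, (m i : ℂ) * (x i : ℂ)) := by
  change (∏ i : ι, fourier (m i) ((x i : ℝ) : UnitAddCircle)) = _
  simp_rw [fourier_coe_apply]
  rw [← Complex.exp_sum, Finset.mul_sum]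
  congr 1
  refine Finset.sum_congr rfl fun i _ ↦ ?_
  push_cast
  ring

/-! ### The Fourier coefficients of the periodisation are the values of `f̂` on `ℤⁿ` -/

/-- Decay with respect to the euclidean norm implies decay with respect to the sup norm of `ℝⁿ`
(`‖x‖_∞ ≤ ‖x‖₂`). [folklore] -/
theorem decay_comp_toLp {f : EuclideanSpace ℝ ι → ℂ} {C b : ℝ} (hb : 0 ≤ b)
    (hdec : ∀ x, ‖f x‖ ≤ C * (1 + ‖x‖) ^ (-b)) (x : ι → ℝ) :
    ‖f (WithLp.toLp 2 x)‖ ≤ C * (1 + ‖x‖) ^ (-b) := by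
  have hC := decayConst_nonneg hdec
  have hx : ‖x‖ ≤ ‖(WithLp.toLp 2 x : EuclideanSpace ℝ ι)‖ :=
    (pi_norm_le_iff_of_nonneg (norm_nonneg _)).mpr fun i ↦ PiLp.norm_apply_le (WithLp.toLp 2 x) i
  refine (hdec _).trans (mul_le_mul_of_nonneg_left ?_ hC)
  exact Real.rpow_le_rpow_of_nonpos (by positivity) (by linarith) (by linarith)

/-- A continuous function with `|f(x)| ≤ C (1 + ‖x‖)^{-b}`, `b > dim V`, is integrable
(Mathlib `integrable_one_add_norm`). [folklore] -/
theorem integrable_of_decay {V : Type*} [NormedAddCommGroup V] [InnerProductSpace ℝ V]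
    [FiniteDimensional ℝ V] [MeasurableSpace V] [BorelSpace V] {f : V → ℂ} (hf : Continuous f)
    {C b : ℝ} (hb : (Module.finrank ℝ V : ℝ) < b) (hdec : ∀ x, ‖f x‖ ≤ C * (1 + ‖x‖) ^ (-b)) :
    Integrable f :=
  ((integrable_one_add_norm hb).const_mul C).mono' hf.aestronglyMeasurable (ae_of_all _ hdec)

/-- The character `x ↦ exp(-2πi m·x)` is `ℤⁿ`-periodic for `m ∈ ℤⁿ`. [folklore] -/
theorem cexp_neg_two_pi_mul_sum_add_intCast (m : ι → ℤ) (x : ι → ℝ) (n : ι → ℤ) :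
    Complex.exp (-(2 * π * Complex.I * ∑ i, (m i : ℂ) * (((x + fun i ↦ (n i : ℝ)) i : ℝ) : ℂ))) =
      Complex.exp (-(2 * π * Complex.I * ∑ i, (m i : ℂ) * (x i : ℂ))) := by
  have hsum : (∑ i, (m i : ℂ) * (((x + fun i ↦ (n i : ℝ)) i : ℝ) : ℂ)) =
      (∑ i, (m i : ℂ) * (x i : ℂ)) + ((∑ i, m i * n i : ℤ) : ℂ) := by
    push_cast
    rw [← Finset.sum_add_distrib]
    refine Finset.sum_congr rfl fun i _ ↦ ?_
    simp only [Pi.add_apply]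
    push_cast
    ring
  rw [hsum, Complex.exp_eq_exp_iff_exists_int]
  refine ⟨-(∑ i, m i * n i), ?_⟩
  push_cast
  ring

/-- The character `x ↦ exp(-2πi m·x)` has absolute value `1`. [folklore] -/
theorem norm_cexp_neg_two_pi_mul_sum (m : ι → ℤ) (x : ι → ℝ) :
    ‖Complex.exp (-(2 * π * Complex.I * ∑ i, (m i : ℂ) * (x i : ℂ)))‖ = 1 := by
  have : -(2 * π * Complex.I * ∑ i, (m i : ℂ) * (x i : ℂ)) =
      ((-(2 * π * ∑ i, (m i : ℝ) * x i) : ℝ) : ℂ) * Complex.I := by push_cast; ring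
  rw [this, Complex.norm_exp_ofReal_mul_I]

/-- **The Fourier coefficients of the periodisation** (the key lemma of the proof of Poisson
summation, Neukirch VII §3, proof of (3.2): "`c_n = ∫ g(x) e^{-2πi n·x} dx = f̂(n)`"): if
`F(x mod ℤⁿ) = ∑_{n ∈ ℤⁿ} f(x + n)` then `F̂(m) = f̂(m)` for all `m ∈ ℤⁿ`. The cube integral of the
sum is the sum of the cube integrals (dominated convergence, `integral_tsum`), the character is
`ℤⁿ`-periodic, and the translates of the cube tile `ℝⁿ`. [cite: NeukirchANT1999, Ch. VII (3.2)] -/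
theorem mFourierCoeff_periodization {f : EuclideanSpace ℝ ι → ℂ} (hf : Continuous f) {C b : ℝ}
    (hb : (Fintype.card ι : ℝ) < b) (hdec : ∀ x, ‖f x‖ ≤ C * (1 + ‖x‖) ^ (-b))
    (F : C(UnitAddTorus ι, ℂ))
    (hF : ∀ x : ι → ℝ, F (fun i ↦ ((x i : ℝ) : UnitAddCircle)) =
      ∑' n : ι → ℤ, f (WithLp.toLp 2 (x + fun i ↦ (n i : ℝ)))) (m : ι → ℤ) :
    UnitAddTorus.mFourierCoeff F m = 𝓕 f (WithLp.toLp 2 fun i ↦ (m i : ℝ)) := by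
  classical
  have hb0 : 0 ≤ b := le_trans (Nat.cast_nonneg _) hb.le
  -- the pulled-back function `g = f ∘ toLp` on `ℝⁿ`: decay, continuity, integrability
  set g : (ι → ℝ) → ℂ := fun x ↦ f (WithLp.toLp 2 x) with hg
  have hgc : Continuous g := by rw [hg]; fun_prop
  have hgdec : ∀ x, ‖g x‖ ≤ C * (1 + ‖x‖) ^ (-b) := decay_comp_toLp hb0 hdec
  have hfi : Integrable f := integrable_of_decay hf (by rwa [finrank_euclideanSpace]) hdec
  have hgi : Integrable g :=
    ((PiLp.volume_preserving_toLp ι).integrable_comp_emb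
      (MeasurableEquiv.toLp 2 (ι → ℝ)).measurableEmbedding).mpr hfi
  -- the character `e(x) = exp(-2πi m·x)`
  set e : (ι → ℝ) → ℂ := fun x ↦ Complex.exp (-(2 * π * Complex.I * ∑ i, (m i : ℂ) * (x i : ℂ)))
    with he
  have hec : Continuous e := by rw [he]; fun_prop
  have henorm : ∀ x, ‖e x‖ = 1 := fun x ↦ norm_cexp_neg_two_pi_mul_sum m x
  have heper : ∀ (x : ι → ℝ) (n : ι → ℤ), e (x + fun i ↦ (n i : ℝ)) = e x := fun x n ↦
    cexp_neg_two_pi_mul_sum_add_intCast m x n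
  -- the unit cube
  set Q : Set (ι → ℝ) := Set.pi Set.univ (fun _ ↦ Set.Ico (0 : ℝ) 1) with hQ
  have hQm : MeasurableSet Q := MeasurableSet.univ_pi fun _ ↦ measurableSet_Ico
  -- Step 1: the Fourier coefficient as a cube integral of `e · ∑ g(x + n)`
  have h1 : UnitAddTorus.mFourierCoeff F m =
      ∫ x in Q, e x * ∑' n : ι → ℤ, g (x + fun i ↦ (n i : ℝ)) := by
    rw [UnitAddTorus.mFourierCoeff_eq_integral F m 0]
    have hset : {x : ι → ℝ | ∀ i, x i ∈ Set.Ioc ((0 : ι → ℝ) i) ((0 : ι → ℝ) i + 1)} =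
        Set.pi Set.univ (fun _ ↦ Set.Ioc (0 : ℝ) 1) := by
      ext x; simp
    have hae : (Set.pi Set.univ (fun _ ↦ Set.Ioc (0 : ℝ) 1) : Set (ι → ℝ)) =ᵐ[volume] Q := by
      refine (Measure.univ_pi_Ioc_ae_eq_Icc (μ := fun _ : ι ↦ (volume : Measure ℝ))
        (f := fun _ ↦ (0:ℝ)) (g := fun _ ↦ 1)).trans ?_
      exact (Measure.univ_pi_Ico_ae_eq_Icc (μ := fun _ : ι ↦ (volume : Measure ℝ))
        (f := fun _ ↦ (0:ℝ)) (g := fun _ ↦ 1)).symm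
    rw [hset, setIntegral_congr_set hae]
    refine setIntegral_congr_fun hQm fun x _ ↦ ?_
    rw [hF x, smul_eq_mul, mFourier_apply_coe]
    congr 1
    rw [he]
    simp only [Pi.neg_apply, Int.cast_neg, neg_mul, Finset.sum_neg_distrib, mul_neg]
  -- Step 2: swap the sum and the cube integral
  have h2 : (∫ x in Q, e x * ∑' n : ι → ℤ, g (x + fun i ↦ (n i : ℝ))) =
      ∑' n : ι → ℤ, ∫ x in Q, e x * g (x + fun i ↦ (n i : ℝ)) := by
    simp_rw [← tsum_mul_left]
    refine integral_tsum (fun n ↦ ?_) ?_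
    · exact (hec.mul (hgc.comp (continuous_id.add continuous_const))).aestronglyMeasurable
    · have hn : ∀ n : ι → ℤ, (∫⁻ x in Q, ‖e x * g (x + fun i ↦ (n i : ℝ))‖ₑ) =
          ∫⁻ x in Q, ‖g (x + fun i ↦ (n i : ℝ))‖ₑ := by
        intro n
        refine lintegral_congr fun x ↦ ?_
        rw [enorm_mul, ← ofReal_norm (e x), henorm, ENNReal.ofReal_one, one_mul]
      simp_rw [hn]
      rw [← lintegral_eq_tsum_lintegral_cube (fun x ↦ ‖g x‖ₑ)]
      exact hgi.2.ne
  -- Step 3: periodicity of `e` and reassembly of the translated cubes into `ℝⁿ`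
  have h3 : (∑' n : ι → ℤ, ∫ x in Q, e x * g (x + fun i ↦ (n i : ℝ))) = ∫ x, e x * g x := by
    rw [integral_eq_tsum_integral_cube (G := fun x ↦ e x * g x)
      (hgi.bdd_mul hec.aestronglyMeasurable (ae_of_all _ fun x ↦ (henorm x).le))]
    refine tsum_congr fun n ↦ setIntegral_congr_fun hQm fun x _ ↦ ?_
    rw [heper]
  -- Step 4: back to the euclidean space and the Fourier integral
  have h4 : (∫ x, e x * g x) = 𝓕 f (WithLp.toLp 2 fun i ↦ (m i : ℝ)) := by
    rw [Real.fourier_eq', ← (PiLp.volume_preserving_toLp ι).integral_comp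
      (MeasurableEquiv.toLp 2 (ι → ℝ)).measurableEmbedding]
    refine integral_congr_ae (ae_of_all _ fun x ↦ ?_)
    simp only [smul_eq_mul, hg, he]
    congr 1
    have hinner : inner ℝ (WithLp.toLp 2 x : EuclideanSpace ℝ ι) (WithLp.toLp 2 fun i ↦ (m i : ℝ)) =
        ∑ i, x i * (m i : ℝ) := by
      simp [PiLp.inner_apply, mul_comm]
    rw [hinner]
    congr 1
    push_cast
    rw [Finset.mul_sum, Finset.mul_sum, Finset.sum_mul, ← Finset.sum_neg_distrib]
    refine Finset.sum_congr rfl fun i _ ↦ ?_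
    ring
  rw [h1, h2, h3, h4]

/-- The monomial `e_m` is `1` at the origin of the torus. [folklore] -/
theorem mFourier_apply_coe_zero (m : ι → ℤ) :
    UnitAddTorus.mFourier m (fun i ↦ (((0 : ι → ℝ) i : ℝ) : UnitAddCircle)) = 1 := by
  rw [mFourier_apply_coe]
  simp

/-- **Poisson summation for the integer lattice** `ℤⁿ ⊂ ℝⁿ` (Neukirch VII (3.2) for
`Γ = ℤⁿ`, with an orthonormal basis; Mathlib's `Real.tsum_eq_tsum_fourier` is the case `n = 1`):
for `f` continuous on `ℝⁿ` with `|f(x)| ≤ C(1 + ‖x‖)^{-b}` for some `b > n` and `∑_{m ∈ ℤⁿ} f̂(m)`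
convergent, `∑_{n ∈ ℤⁿ} f(n) = ∑_{m ∈ ℤⁿ} f̂(m)`. [cite: NeukirchANT1999, Ch. VII (3.2)] -/
theorem tsum_eq_tsum_fourier_intLattice {f : EuclideanSpace ℝ ι → ℂ} (hf : Continuous f)
    {C b : ℝ} (hb : (Fintype.card ι : ℝ) < b) (hdec : ∀ x, ‖f x‖ ≤ C * (1 + ‖x‖) ^ (-b))
    (hsum : Summable fun m : ι → ℤ ↦ 𝓕 f (WithLp.toLp 2 fun i ↦ (m i : ℝ))) :
    ∑' n : ι → ℤ, f (WithLp.toLp 2 fun i ↦ (n i : ℝ)) =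
      ∑' m : ι → ℤ, 𝓕 f (WithLp.toLp 2 fun i ↦ (m i : ℝ)) := by
  classical
  have hb0 : 0 ≤ b := le_trans (Nat.cast_nonneg _) hb.le
  set g : (ι → ℝ) → ℂ := fun x ↦ f (WithLp.toLp 2 x) with hg
  have hgc : Continuous g := by rw [hg]; fun_prop
  have hgdec : ∀ x, ‖g x‖ ≤ C * (1 + ‖x‖) ^ (-b) := decay_comp_toLp hb0 hdec
  -- the periodisation and its descent to the torus
  set P : (ι → ℝ) → ℂ := fun x ↦ ∑' n : ι → ℤ, g (x + fun i ↦ (n i : ℝ)) with hP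
  have hPc : Continuous P := continuous_periodization hgc hb hgdec
  have hPper : ∀ (x : ι → ℝ) (k : ι → ℤ), P (x + fun i ↦ (k i : ℝ)) = P x := fun x k ↦
    periodization_add_intCast g x k
  obtain ⟨F, hF⟩ := exists_continuousMap_torus hPc hPper
  -- its Fourier coefficients
  have hcoeff : UnitAddTorus.mFourierCoeff F = fun m ↦ 𝓕 f (WithLp.toLp 2 fun i ↦ (m i : ℝ)) := by
    funext m
    exact mFourierCoeff_periodization hf hb hdec F (fun x ↦ by rw [hF x]) m
  -- pointwise convergence of the Fourier series at the origin
  have hS : Summable (UnitAddTorus.mFourierCoeff F) := by rwa [hcoeff]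
  have key := UnitAddTorus.hasSum_mFourier_series_apply_of_summable hS
    (fun i ↦ (((0 : ι → ℝ) i : ℝ) : UnitAddCircle))
  simp only [hcoeff, mFourier_apply_coe_zero, smul_eq_mul, mul_one] at key
  rw [hF 0, hP] at key
  simp only [zero_add] at key
  exact key.tsum_eq.symm

end IntLattice

/-! ## Step 2: general lattices `Γ ⊂ V` (reduction to `ℤⁿ` by a lattice basis) -/

section General

variable {V : Type*} [NormedAddCommGroup V] [InnerProductSpace ℝ V] [FiniteDimensional ℝ V]
  [MeasurableSpace V] [BorelSpace V]

omit [FiniteDimensional ℝ V] [MeasurableSpace V] [BorelSpace V] in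
/-- Coercion of the lattice vector with coordinates `n` in a `ℤ`-basis `bΓ` of `Γ`. [folklore] -/
theorem coe_equivFun_symm {Γ : Submodule ℤ V} {ι : Type*} [Fintype ι] (bΓ : Module.Basis ι ℤ Γ)
    (n : ι → ℤ) :
    ((bΓ.equivFun.symm n : Γ) : V) = ∑ i, (n i : ℝ) • ((bΓ i : Γ) : V) := by
  rw [Module.Basis.equivFun_symm_apply, Submodule.coe_sum]
  refine Finset.sum_congr rfl fun i _ ↦ ?_
  rw [Submodule.coe_smul_of_tower, Int.cast_smul_eq_zsmul]

omit [FiniteDimensional ℝ V] [MeasurableSpace V] [BorelSpace V] in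
/-- Coercion of the vector with integer coordinates `m` in an `ℝ`-basis `b`, as an element of the
`ℤ`-span of `b`. [folklore] -/
theorem coe_restrictScalars_equivFun_symm {ι : Type*} [Fintype ι] (b : Module.Basis ι ℝ V)
    (m : ι → ℤ) :
    ((((b.restrictScalars ℤ).equivFun.symm m : span ℤ (Set.range b))) : V) =
      ∑ i, (m i : ℝ) • b i := by
  rw [Module.Basis.equivFun_symm_apply, Submodule.coe_sum]
  refine Finset.sum_congr rfl fun i _ ↦ ?_
  rw [Submodule.coe_smul_of_tower, Module.Basis.restrictScalars_apply, Int.cast_smul_eq_zsmul]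

omit [InnerProductSpace ℝ V] [FiniteDimensional ℝ V] [MeasurableSpace V] [BorelSpace V] in
/-- Polynomial decay is preserved by linear changes of variables (with the constant multiplied by
`max(1, ‖A⁻¹‖)^b`). [folklore] -/
theorem decay_comp_continuousLinearEquiv [NormedSpace ℝ V] {E : Type*} [NormedAddCommGroup E]
    [NormedSpace ℝ E] {f : V → ℂ} {C b : ℝ} (hb : 0 ≤ b)
    (hdec : ∀ x, ‖f x‖ ≤ C * (1 + ‖x‖) ^ (-b)) (A : E ≃L[ℝ] V) (x : E) :
    ‖f (A x)‖ ≤ C * (max 1 ‖(A.symm : V →L[ℝ] E)‖) ^ b * (1 + ‖x‖) ^ (-b) := by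
  have hC := decayConst_nonneg hdec
  set K : ℝ := max 1 ‖(A.symm : V →L[ℝ] E)‖ with hK
  have hK1 : 1 ≤ K := le_max_left _ _
  have hxK : ‖x‖ ≤ K * ‖A x‖ := by
    calc ‖x‖ = ‖(A.symm : V →L[ℝ] E) (A x)‖ := by simp
      _ ≤ ‖(A.symm : V →L[ℝ] E)‖ * ‖A x‖ := ContinuousLinearMap.le_opNorm _ _
      _ ≤ K * ‖A x‖ := by gcongr; exact le_max_right _ _
  have hkey : (1 + ‖x‖) / K ≤ 1 + ‖A x‖ := by
    rw [div_le_iff₀ (by positivity)]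
    nlinarith [hxK, hK1, norm_nonneg (A x)]
  have hpos : 0 < (1 + ‖x‖) / K := by positivity
  have hb' : -b ≤ 0 := by linarith
  calc ‖f (A x)‖ ≤ C * (1 + ‖A x‖) ^ (-b) := hdec _
    _ ≤ C * ((1 + ‖x‖) / K) ^ (-b) :=
        mul_le_mul_of_nonneg_left (Real.rpow_le_rpow_of_nonpos hpos hkey hb') hC
    _ = C * K ^ b * (1 + ‖x‖) ^ (-b) := by
        rw [Real.div_rpow (by positivity) (by positivity), Real.rpow_neg (by positivity : (0:ℝ) ≤ K),
          div_inv_eq_mul]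
        ring

/-- **Jacobian of a lattice-basis isomorphism**: if `A : ℝⁿ ≃ V` maps the standard basis to a
`ℤ`-basis of the lattice `Γ`, then `A_* vol_{ℝⁿ} = vol(Γ)⁻¹ · vol_V` (the image of the unit cube is
a fundamental mesh of `Γ`; Haar measures are proportional). [folklore] -/
theorem map_volume_eq_inv_covolume_smul (Γ : Submodule ℤ V) [DiscreteTopology Γ] [IsZLattice ℝ Γ]
    {ι : Type*} [Fintype ι] (bΓ : Module.Basis ι ℤ Γ) (A : EuclideanSpace ℝ ι ≃L[ℝ] V)
    (hA : ∀ x, A x = ∑ i, x i • ((bΓ i : Γ) : V)) :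
    Measure.map A volume = (ENNReal.ofReal (ZLattice.covolume Γ))⁻¹ • (volume : Measure V) := by
  classical
  set bV : Module.Basis ι ℝ V := bΓ.ofZLatticeBasis ℝ Γ with hbV
  -- `A` maps the standard orthonormal basis to `bV`
  have hmap : (EuclideanSpace.basisFun ι ℝ).toBasis.map (A : EuclideanSpace ℝ ι ≃ₗ[ℝ] V) = bV := by
    refine Module.Basis.eq_of_apply_eq fun i ↦ ?_
    rw [Module.Basis.map_apply, OrthonormalBasis.coe_toBasis, EuclideanSpace.basisFun_apply]
    change A (EuclideanSpace.single i 1) = bV i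
    rw [hA, hbV, Module.Basis.ofZLatticeBasis_apply]
    simp
  -- the fundamental mesh of `bV` has volume `covolume Γ`
  have hF : volume (ZSpan.fundamentalDomain bV) = ENNReal.ofReal (ZLattice.covolume Γ) := by
    rw [ZLattice.covolume_eq_measure_fundamentalDomain Γ volume
      (ZLattice.isAddFundamentalDomain bΓ volume), measureReal_def, ENNReal.ofReal_toReal]
    exact ((ZSpan.fundamentalDomain_isBounded bV).measure_lt_top).ne
  have hF0 : volume (ZSpan.fundamentalDomain bV) ≠ 0 := by
    rw [hF, ne_eq, ENNReal.ofReal_eq_zero, not_le]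
    exact ZLattice.covolume_pos Γ volume
  have hFtop : volume (ZSpan.fundamentalDomain bV) ≠ ⊤ := by rw [hF]; exact ENNReal.ofReal_ne_top
  -- Haar measure bookkeeping
  rw [← (EuclideanSpace.basisFun ι ℝ).addHaar_eq_volume, Module.Basis.map_addHaar, hmap, ← hF]
  have huniq := Measure.addHaarMeasure_unique (volume : Measure V) bV.parallelepiped
  rw [← Module.Basis.addHaar_def, Module.Basis.coe_parallelepiped,
    ← measure_congr (ZSpan.fundamentalDomain_ae_parallelepiped bV volume)] at huniq
  calc bV.addHaar = (volume (ZSpan.fundamentalDomain bV))⁻¹ •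
        (volume (ZSpan.fundamentalDomain bV) • bV.addHaar) := by
          rw [smul_smul, ENNReal.inv_mul_cancel hF0 hFtop, one_smul]
    _ = (volume (ZSpan.fundamentalDomain bV))⁻¹ • volume := by rw [← huniq]

/-- **Linear change of variables** `∫_{ℝⁿ} G(Ax) dx = vol(Γ)⁻¹ ∫_V G(v) dv` for a lattice-basis
isomorphism `A`. [folklore] -/
theorem integral_comp_eq_inv_covolume_smul (Γ : Submodule ℤ V) [DiscreteTopology Γ] [IsZLattice ℝ Γ]
    {ι : Type*} [Fintype ι] (bΓ : Module.Basis ι ℤ Γ) (A : EuclideanSpace ℝ ι ≃L[ℝ] V)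
    (hA : ∀ x, A x = ∑ i, x i • ((bΓ i : Γ) : V)) (G : V → ℂ) :
    ∫ x, G (A x) = (ZLattice.covolume Γ)⁻¹ • ∫ v, G v := by
  have h := map_volume_eq_inv_covolume_smul Γ bΓ A hA
  have h1 := integral_map_equiv (μ := volume) A.toHomeomorph.toMeasurableEquiv G
  simp only [Homeomorph.toMeasurableEquiv_coe, ContinuousLinearEquiv.coe_toHomeomorph] at h1
  rw [← h1, h, integral_smul_measure, ENNReal.toReal_inv,
    ENNReal.toReal_ofReal (ZLattice.covolume_pos Γ volume).le]

omit [FiniteDimensional ℝ V] [MeasurableSpace V] [BorelSpace V] in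
/-- The dual basis pairs integrally-indexed coordinates: `⟪∑ xᵢ bᵢ, ∑ ξⱼ b^∨ⱼ⟫ = ∑ xᵢ ξᵢ`. [folklore] -/
theorem inner_sum_smul_dualBasis {ι : Type*} [Fintype ι] [DecidableEq ι] (b : Module.Basis ι ℝ V)
    (x ξ : ι → ℝ) :
    inner ℝ (∑ i, x i • b i)
      (∑ j, ξ j • LinearMap.BilinForm.dualBasis (innerₗ V) Literature.Algebra.EuclideanLattices.innerₗ_nondegenerate b j) =
      ∑ i, x i * ξ i := by
  simp_rw [sum_inner, inner_sum, real_inner_smul_left, real_inner_smul_right]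
  have hd : ∀ i j, inner ℝ (b i)
      (LinearMap.BilinForm.dualBasis (innerₗ V) Literature.Algebra.EuclideanLattices.innerₗ_nondegenerate b j) =
        if i = j then 1 else 0 := by
    intro i j
    rw [← real_inner_comm, ← innerₗ_apply_apply, LinearMap.BilinForm.apply_dualBasis_left]
  simp_rw [hd]
  simp

/-- **Fourier transform under a lattice-basis isomorphism**: `(f ∘ A)^(ξ) = vol(Γ)⁻¹ f̂(A^* ξ)`
where `A^* ξ = ∑ ξⱼ b^∨ⱼ` (dual basis). [folklore] -/
theorem fourier_comp_eq_inv_covolume_smul (Γ : Submodule ℤ V) [DiscreteTopology Γ] [IsZLattice ℝ Γ]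
    {ι : Type*} [Fintype ι] [DecidableEq ι] (bΓ : Module.Basis ι ℤ Γ)
    (A : EuclideanSpace ℝ ι ≃L[ℝ] V) (hA : ∀ x, A x = ∑ i, x i • ((bΓ i : Γ) : V)) (f : V → ℂ)
    (ξ : EuclideanSpace ℝ ι) :
    𝓕 (fun x ↦ f (A x)) ξ = (ZLattice.covolume Γ)⁻¹ •
      𝓕 f (∑ j, ξ j • LinearMap.BilinForm.dualBasis (innerₗ V) Literature.Algebra.EuclideanLattices.innerₗ_nondegenerate
        (bΓ.ofZLatticeBasis ℝ Γ) j) := by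
  set d := LinearMap.BilinForm.dualBasis (innerₗ V) Literature.Algebra.EuclideanLattices.innerₗ_nondegenerate
    (bΓ.ofZLatticeBasis ℝ Γ) with hd
  rw [Real.fourier_eq, Real.fourier_eq]
  have hinner : ∀ x : EuclideanSpace ℝ ι, inner ℝ x ξ = inner ℝ (A x) (∑ j, ξ j • d j) := by
    intro x
    rw [hA]
    have : ∀ i, ((bΓ i : Γ) : V) = bΓ.ofZLatticeBasis ℝ Γ i := fun i ↦
      (Module.Basis.ofZLatticeBasis_apply ℝ Γ bΓ i).symm
    simp_rw [this]
    rw [hd, inner_sum_smul_dualBasis]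
    simp [PiLp.inner_apply, mul_comm]
  simp_rw [hinner]
  exact integral_comp_eq_inv_covolume_smul Γ bΓ A hA (fun v ↦ 𝐞 (-inner ℝ v (∑ j, ξ j • d j)) • f v)

/-- Poisson summation for lattices, decay form, relative to a chosen `ℤ`-basis of `Γ` (the
reduction to `tsum_eq_tsum_fourier_intLattice`). [cite: NeukirchANT1999, Ch. VII (3.2)] -/
theorem tsum_eq_tsum_fourier_of_rpow_decay_of_basis (Γ : Submodule ℤ V) [DiscreteTopology Γ]
    [IsZLattice ℝ Γ] {ι : Type*} [Fintype ι] [DecidableEq ι] (bΓ : Module.Basis ι ℤ Γ)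
    {f : V → ℂ} (hf : Continuous f) {C b : ℝ} (hb : (Module.finrank ℝ V : ℝ) < b)
    (hdec : ∀ x, ‖f x‖ ≤ C * (1 + ‖x‖) ^ (-b))
    (hsum : Summable fun g' : Literature.Algebra.EuclideanLattices.dualLattice Γ ↦ 𝓕 f g') :
    ∑' g : Γ, f g = ((ZLattice.covolume Γ)⁻¹ : ℝ) • ∑' g' : Literature.Algebra.EuclideanLattices.dualLattice Γ, 𝓕 f g' := by
  -- the associated `ℝ`-basis of `V`, its dual basis, and `A : ℝⁿ ≃ V`
  set bV : Module.Basis ι ℝ V := bΓ.ofZLatticeBasis ℝ Γ with hbV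
  set d : Module.Basis ι ℝ V :=
    LinearMap.BilinForm.dualBasis (innerₗ V) Literature.Algebra.EuclideanLattices.innerₗ_nondegenerate bV with hd
  set A : EuclideanSpace ℝ ι ≃L[ℝ] V :=
    (PiLp.continuousLinearEquiv 2 ℝ (fun _ : ι ↦ ℝ)).trans
      bV.equivFun.symm.toContinuousLinearEquiv with hAdef
  have hA : ∀ x, A x = ∑ i, x i • ((bΓ i : Γ) : V) := by
    intro x
    rw [hAdef, ContinuousLinearEquiv.trans_apply, LinearEquiv.coe_toContinuousLinearEquiv',
      Module.Basis.equivFun_symm_apply]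
    refine Finset.sum_congr rfl fun i _ ↦ ?_
    rw [hbV, Module.Basis.ofZLatticeBasis_apply, PiLp.continuousLinearEquiv_apply]
  have hcard : (Fintype.card ι : ℝ) < b := by
    rwa [Module.finrank_eq_card_basis bV] at hb
  have hb0 : 0 ≤ b := le_trans (Nat.cast_nonneg _) hb.le
  -- the function `F = f ∘ A` on `ℝⁿ`
  have hFc : Continuous (fun x : EuclideanSpace ℝ ι ↦ f (A x)) := hf.comp A.continuous
  have hFdec : ∀ x : EuclideanSpace ℝ ι, ‖f (A x)‖ ≤
      C * (max 1 ‖(A.symm : V →L[ℝ] EuclideanSpace ℝ ι)‖) ^ b * (1 + ‖x‖) ^ (-b) :=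
    decay_comp_continuousLinearEquiv hb0 hdec A
  -- its Fourier transform on `ℤⁿ`
  have hFfourier : ∀ m : ι → ℤ,
      𝓕 (fun x : EuclideanSpace ℝ ι ↦ f (A x)) (WithLp.toLp 2 fun i ↦ (m i : ℝ)) =
        (ZLattice.covolume Γ)⁻¹ • 𝓕 f (∑ j, (m j : ℝ) • d j) := by
    intro m
    rw [fourier_comp_eq_inv_covolume_smul Γ bΓ A hA f]
  -- the dual lattice is parametrised by `ℤⁿ` via the dual basis
  have hdual : Literature.Algebra.EuclideanLattices.dualLattice Γ = span ℤ (Set.range d) :=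
    Literature.Algebra.EuclideanLattices.dualLattice_eq_span_dualBasis Γ bΓ
  let eD : (ι → ℤ) ≃ Literature.Algebra.EuclideanLattices.dualLattice Γ :=
    ((d.restrictScalars ℤ).equivFun.symm.toEquiv).trans (LinearEquiv.ofEq _ _ hdual.symm).toEquiv
  have heD : ∀ m, ((eD m : Literature.Algebra.EuclideanLattices.dualLattice Γ) : V) = ∑ j, (m j : ℝ) • d j := by
    intro m
    simp only [eD, Equiv.trans_apply, LinearEquiv.coe_toEquiv, LinearEquiv.coe_ofEq_apply]
    exact coe_restrictScalars_equivFun_symm d m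
  -- `Γ` is parametrised by `ℤⁿ` via `bΓ`
  let eΓ : (ι → ℤ) ≃ Γ := bΓ.equivFun.symm.toEquiv
  have heΓ : ∀ n, ((eΓ n : Γ) : V) = A (WithLp.toLp 2 fun i ↦ (n i : ℝ)) := by
    intro n
    rw [hA]
    exact coe_equivFun_symm bΓ n
  -- summability of `𝓕 f` along the dual basis, and of `𝓕 (f ∘ A)` over `ℤⁿ`
  have hsumD : Summable fun m : ι → ℤ ↦ 𝓕 f (∑ j, (m j : ℝ) • d j) := by
    have := (eD.summable_iff (f := fun g' : Literature.Algebra.EuclideanLattices.dualLattice Γ ↦ 𝓕 f g')).mpr hsum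
    refine this.congr fun m ↦ ?_
    simp only [Function.comp_apply, heD]
  have hsumF : Summable fun m : ι → ℤ ↦
      𝓕 (fun x : EuclideanSpace ℝ ι ↦ f (A x)) (WithLp.toLp 2 fun i ↦ (m i : ℝ)) := by
    simp_rw [hFfourier]
    exact hsumD.const_smul _
  -- Poisson summation on `ℤⁿ` for `f ∘ A`, transported back
  have key := tsum_eq_tsum_fourier_intLattice hFc hcard hFdec hsumF
  rw [← eΓ.tsum_eq]
  simp_rw [heΓ]
  rw [key]
  simp_rw [hFfourier]
  rw [hsumD.tsum_const_smul]
  congr 1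
  rw [← eD.tsum_eq]
  exact tsum_congr fun m ↦ by rw [heD]

/-- **Poisson summation for lattices, decay form** (Neukirch VII (3.2), for the class of functions
actually needed for theta series): let `Γ` be a full lattice in the euclidean space `V`, `f`
continuous with `|f(x)| ≤ C(1 + ‖x‖)^{-b}` for some `b > dim V`, and `∑_{g' ∈ Γ'} f̂(g')` convergent.
Then `∑_{g ∈ Γ} f(g) = vol(Γ)⁻¹ ∑_{g' ∈ Γ'} f̂(g')` with `Γ' = Literature.Lattice.dualLattice Γ`. Reduction to
`tsum_eq_tsum_fourier_intLattice` by a `ℤ`-basis of `Γ`. [cite: NeukirchANT1999, Ch. VII (3.2)] -/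
theorem tsum_eq_tsum_fourier_of_rpow_decay (Γ : Submodule ℤ V) [DiscreteTopology Γ] [IsZLattice ℝ Γ]
    {f : V → ℂ} (hf : Continuous f) {C b : ℝ} (hb : (Module.finrank ℝ V : ℝ) < b)
    (hdec : ∀ x, ‖f x‖ ≤ C * (1 + ‖x‖) ^ (-b))
    (hsum : Summable fun g' : Literature.Algebra.EuclideanLattices.dualLattice Γ ↦ 𝓕 f g') :
    ∑' g : Γ, f g = ((ZLattice.covolume Γ)⁻¹ : ℝ) • ∑' g' : Literature.Algebra.EuclideanLattices.dualLattice Γ, 𝓕 f g' := by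
  classical
  exact tsum_eq_tsum_fourier_of_rpow_decay_of_basis Γ (Module.Free.chooseBasis ℤ Γ) hf hb hdec hsum

/-! ## Step 3: Schwartz functions — discharge of `poissonSummation_zlattice` -/

omit [MeasurableSpace V] [BorelSpace V] in
/-- **Rapid decay is summable over lattices**: if `|g(x)| ≤ C (1 + ‖x‖)^{-b}` with `b > dim V` then
`∑_{z ∈ L} g(z)` converges absolutely for every full lattice `L` (Mathlib
`ZLattice.summable_norm_rpow`). [folklore] -/
theorem summable_of_decay_zlattice (L : Submodule ℤ V) [DiscreteTopology L] [IsZLattice ℝ L]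
    {g : V → ℂ} {C b : ℝ} (hb : (Module.finrank ℝ V : ℝ) < b)
    (hg : ∀ x, ‖g x‖ ≤ C * (1 + ‖x‖) ^ (-b)) : Summable fun z : L ↦ g z := by
  have hC := decayConst_nonneg hg
  have hrank : -b < -(Module.finrank ℤ L : ℝ) := by rw [ZLattice.rank ℝ L]; linarith
  refine Summable.of_norm_bounded_eventually
    ((ZLattice.summable_norm_rpow L (-b) hrank).mul_left C) ?_
  refine Filter.eventually_cofinite.mpr ((Set.finite_singleton (0 : L)).subset fun z hz ↦ ?_)
  rw [Set.mem_singleton_iff]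
  by_contra h0
  apply hz
  have hpos : 0 < ‖z‖ := norm_pos_iff.mpr h0
  have hle : ‖z‖ ≤ 1 + ‖(z : V)‖ := by
    rw [Submodule.coe_norm]; linarith
  calc ‖g z‖ ≤ C * (1 + ‖(z : V)‖) ^ (-b) := hg _
    _ ≤ C * ‖z‖ ^ (-b) :=
        mul_le_mul_of_nonneg_left (Real.rpow_le_rpow_of_nonpos hpos hle (by linarith)) hC

omit [FiniteDimensional ℝ V] [MeasurableSpace V] [BorelSpace V] in
/-- **Schwartz functions decay faster than any power**: `|f(x)| ≤ C_k (1 + ‖x‖)^{-k}`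
(Mathlib `SchwartzMap.one_add_le_sup_seminorm_apply`). [folklore] -/
theorem schwartz_decay (f : 𝓢(V, ℂ)) (k : ℕ) :
    ∃ C : ℝ, ∀ x, ‖f x‖ ≤ C * (1 + ‖x‖) ^ (-(k : ℝ)) := by
  refine ⟨2 ^ k * ((Finset.Iic (k, 0)).sup fun m ↦ SchwartzMap.seminorm ℝ m.1 m.2) f, fun x ↦ ?_⟩
  have h := SchwartzMap.one_add_le_sup_seminorm_apply (𝕜 := ℝ) (m := (k, 0)) le_rfl le_rfl f x
  rw [norm_iteratedFDeriv_zero] at h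
  have hpos : 0 < (1 + ‖x‖) ^ k := by positivity
  simp only at h
  rw [Real.rpow_neg (by positivity), Real.rpow_natCast, ← div_eq_mul_inv, le_div_iff₀ hpos]
  linarith

/-- **Poisson summation formula** — discharge of the named fact `Literature.NumberTheory.LFunctions.poissonSummation_zlattice`
(Neukirch VII (3.2) Proposition): for a complete lattice `Γ` in a euclidean vector space `V` and a
Schwartz function `f`, `∑_{g ∈ Γ} f(g) = vol(Γ)⁻¹ ∑_{g' ∈ Γ'} f̂(g')`. From the decay form
`tsum_eq_tsum_fourier_of_rpow_decay`: `f` and `f̂` (again a Schwartz function, Mathlib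
`SchwartzMap.fourier_coe`) decay faster than `(1 + ‖x‖)^{-dim V - 1}`.
[cite: NeukirchANT1999, Ch. VII (3.2)] -/
theorem poissonSummation_zlattice_holds : poissonSummation_zlattice := by
  intro V _ _ _ _ _ Γ _ _ f
  obtain ⟨C, hC⟩ := schwartz_decay f (Module.finrank ℝ V + 1)
  have hb : (Module.finrank ℝ V : ℝ) < ((Module.finrank ℝ V + 1 : ℕ) : ℝ) := by push_cast; linarith
  obtain ⟨C', hC'⟩ := schwartz_decay (𝓕 f : 𝓢(V, ℂ)) (Module.finrank ℝ V + 1)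
  have hsum : Summable fun g' : Literature.Algebra.EuclideanLattices.dualLattice Γ ↦ 𝓕 (⇑f) g' :=
    summable_of_decay_zlattice (Literature.Algebra.EuclideanLattices.dualLattice Γ) hb hC'
  exact tsum_eq_tsum_fourier_of_rpow_decay Γ f.continuous hb hC hsum

end General

end Fourier

end Literature.NumberTheory.LFunctions
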